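import Literature.AnabelianGeometry.SemiGraphs.TemperedVerticialInjective
import HarnessLib

/-!
# [SemiAnbd] §3: fibrewise products in `B^cov(G)` and underlying bijections of isomorphisms of
# `B^temp(Π)` — bookkeeping for the gluing arguments of Propositions 2.5/2.6 and Theorem 3.7

Mochizuki, *Semi-graphs of anabelioids*, Publ. RIMS **42** (2006), §3, manuscript pp. 36–37
[cite: MochizukiSemiAnbd2006, Def 3.5(ii) p.37]: `B^cov(G)` has fibrewise finite limits (the
componentwise description is brick B0, `TemperedCoveringsLimitsProofs.lean`); here only the explicit
BINARY PRODUCT `S × T` ("the fiber product covering", pp. 39–40, of two coverings of `G`) is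
recorded as a construction with its points = pairs of points (`CovObj.prod`), together with: the
product of finite coverings is finite with nonempty fibres when the factors are
(`prod_isFinite`, `prod_hasNonemptyFibres`), and a product splits a covering at a point as soon as
the stabilisers of the pairs do (`splitsAt_prod_iff`).  Also the underlying equivariant bijection of
an isomorphism of `B^temp(Π)` (`BTemp.equivOfIso`), used to glue products.  Local presentation of
`TemperedCoverings.lean`; plain bookkeeping, no statement of the paper is involved.
-/

open CategoryTheory Topology

namespace Literature.AnabelianGeometry.SemiGraphs

universe u

namespace BTemp

variable {G : Type u} [Group G] [TopologicalSpace G]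

/-- Equivariance of a morphism of `B^temp(Π)`, pointwise. [cite: MochizukiSemiAnbd2006, §3 p.33] -/
theorem hom_ρ_apply {X Y : BTemp G} (f : X ⟶ Y) (g : G) (x : X.obj.V) :
    f.hom.hom (X.obj.ρ g x) = Y.obj.ρ g (f.hom.hom x) := by
  have e := ConcreteCategory.congr_hom (f.hom.comm g) x
  simp only [types_comp_apply] at e
  exact e

/-- The underlying bijection of an isomorphism of `B^temp(Π)`. [cite: MochizukiSemiAnbd2006, §3 p.33] -/
def equivOfIso {X Y : BTemp G} (i : X ≅ Y) : X.obj.V ≃ Y.obj.V :=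
  (((temperedAction G).ι ⋙ Action.forget (Type u) G).mapIso i).toEquiv

/-- The underlying bijection of an isomorphism is the underlying map of its `hom`.
[cite: MochizukiSemiAnbd2006, §3 p.33] -/
theorem equivOfIso_apply {X Y : BTemp G} (i : X ≅ Y) (x : X.obj.V) :
    equivOfIso i x = i.hom.hom.hom x := rfl

/-- The inverse of the underlying bijection is the underlying map of the `inv`.
[cite: MochizukiSemiAnbd2006, §3 p.33] -/
theorem equivOfIso_symm_apply {X Y : BTemp G} (i : X ≅ Y) (y : Y.obj.V) :
    (equivOfIso i).symm y = i.inv.hom.hom y := rfl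

/-- The underlying bijection of an isomorphism is equivariant. [cite: MochizukiSemiAnbd2006, §3 p.33] -/
theorem equivOfIso_ρ {X Y : BTemp G} (i : X ≅ Y) (g : G) (x : X.obj.V) :
    equivOfIso i (X.obj.ρ g x) = Y.obj.ρ g (equivOfIso i x) :=
  hom_ρ_apply i.hom g x

/-- The product `X × Y` of two objects of `B^temp(Π)` with the diagonal action (countable;
stabilisers = intersections of stabilisers, open). [cite: MochizukiSemiAnbd2006, Def 3.1(iii) p.33] -/
def prodObj (X Y : BTemp G) : BTemp G :=
  ⟨{ V := X.obj.V × Y.obj.V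
     ρ := { toFun := fun g => TypeCat.ofHom fun p => (X.obj.ρ g p.1, Y.obj.ρ g p.2)
            map_one' := by
              refine ConcreteCategory.hom_ext _ _ fun p => ?_
              simp only [map_one]
              rfl
            map_mul' := fun g h => by
              refine ConcreteCategory.hom_ext _ _ fun p => ?_
              simp only [map_mul]
              rfl } }, by
    haveI : Countable X.obj.V := X.property.1
    haveI : Countable Y.obj.V := Y.property.1
    refine ⟨inferInstanceAs (Countable (X.obj.V × Y.obj.V)), fun p => ?_⟩
    have : {g : G | (TypeCat.ofHom fun q : X.obj.V × Y.obj.V => (X.obj.ρ g q.1, Y.obj.ρ g q.2)) p = p}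
        = {g : G | X.obj.ρ g p.1 = p.1} ∩ {g : G | Y.obj.ρ g p.2 = p.2} := by
      ext g
      simp only [Set.mem_setOf_eq, Set.mem_inter_iff, TypeCat.ofHom_apply, Prod.ext_iff]
    exact this ▸ (X.property.2 p.1).inter (Y.property.2 p.2)⟩

/-- The action on the product, unfolded. [cite: MochizukiSemiAnbd2006, Def 3.1(iii) p.33] -/
theorem prodObj_ρ (X Y : BTemp G) (g : G) (p : X.obj.V × Y.obj.V) :
    (prodObj X Y).obj.ρ g p = (X.obj.ρ g p.1, Y.obj.ρ g p.2) := rfl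

/-- Restriction of scalars commutes with the product, on the nose for the action.
[cite: MochizukiSemiAnbd2006, Rmk 3.1.2 p.34] -/
theorem res_prodObj_ρ {H : Type u} [Group H] [TopologicalSpace H] (φ : H →ₜ* G) (X Y : BTemp G)
    (h : H) (p : X.obj.V × Y.obj.V) :
    ((BTemp.res φ).obj (prodObj X Y)).obj.ρ h p =
      (((BTemp.res φ).obj X).obj.ρ h p.1, ((BTemp.res φ).obj Y).obj.ρ h p.2) := rfl

/-- Products of isomorphisms: `X ≅ res X'`, `Y ≅ res Y'` give `X × Y ≅ res (X' × Y')`.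
[cite: MochizukiSemiAnbd2006, Rmk 3.1.2 p.34] -/
def prodIsoRes {H : Type u} [Group H] [TopologicalSpace H] (φ : H →ₜ* G) {X Y : BTemp H}
    {X' Y' : BTemp G} (i : X ≅ (BTemp.res φ).obj X') (j : Y ≅ (BTemp.res φ).obj Y') :
    prodObj X Y ≅ (BTemp.res φ).obj (prodObj X' Y') :=
  BTemp.isoOfEquiv ((equivOfIso i).prodCongr (equivOfIso j)) fun h p => by
    change (equivOfIso i (X.obj.ρ h p.1), equivOfIso j (Y.obj.ρ h p.2)) =
      (X'.obj.ρ (φ h) (equivOfIso i p.1), Y'.obj.ρ (φ h) (equivOfIso j p.2))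
    rw [equivOfIso_ρ, equivOfIso_ρ]
    rfl

end BTemp

namespace ProfiniteSemiGraph

variable {𝒢 : ProfiniteSemiGraph.{u}}

namespace CovObj

/-- **The product covering** `S × T` of two objects of `B^cov(G)` (fibrewise products, diagonal
actions, product gluings) — "the fiber product covering" of pp. 39–40 over the final object.
[cite: MochizukiSemiAnbd2006, Prop 3.6 p.39] -/
def prod (S T : CovObj 𝒢) : CovObj 𝒢 where
  SV w := BTemp.prodObj (S.SV w) (T.SV w)
  SE e := BTemp.prodObj (S.SE e) (T.SE e)
  glue b v h := BTemp.prodIsoRes (𝒢.brHom b v h) (S.glue b v h) (T.glue b v h)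

/-- The product of finite coverings is finite. [cite: MochizukiSemiAnbd2006, Prop 3.6 p.39] -/
theorem prod_isFinite {S T : CovObj 𝒢} (hS : S.IsFinite) (hT : T.IsFinite) : (S.prod T).IsFinite :=
  ⟨fun w => by
    haveI := hS.finite_V w; haveI := hT.finite_V w
    exact inferInstanceAs (Finite ((S.SV w).obj.V × (T.SV w).obj.V)),
   fun e => by
    haveI := hS.finite_E e; haveI := hT.finite_E e
    exact inferInstanceAs (Finite ((S.SE e).obj.V × (T.SE e).obj.V))⟩

/-- The product of coverings with nonempty fibres has nonempty fibres.
[cite: MochizukiSemiAnbd2006, Prop 3.6 p.39] -/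
theorem prod_hasNonemptyFibres {S T : CovObj 𝒢} (hS : S.HasNonemptyFibres)
    (hT : T.HasNonemptyFibres) : (S.prod T).HasNonemptyFibres :=
  ⟨fun w => by
    obtain ⟨x⟩ := hS.nonempty_V w; obtain ⟨y⟩ := hT.nonempty_V w
    exact ⟨((x, y) : (S.SV w).obj.V × (T.SV w).obj.V)⟩,
   fun e => by
    obtain ⟨x⟩ := hS.nonempty_E e; obtain ⟨y⟩ := hT.nonempty_E e
    exact ⟨((x, y) : (S.SE e).obj.V × (T.SE e).obj.V)⟩⟩

/-- A product `F × F'` splits `S` at a vertex point `(w, s)` as soon as every element fixing some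
point of `F_w` AND some point of `F'_w` fixes `s`. [cite: MochizukiSemiAnbd2006, Def 3.5(ii) p.37] -/
theorem prod_splitsAt_inl {F F' S : CovObj 𝒢} {w : 𝒢.graph.Vertex} {s : (S.SV w).obj.V}
    (h : ∀ (x : (F.SV w).obj.V) (x' : (F'.SV w).obj.V) (γ : 𝒢.Gv w),
      (F.SV w).obj.ρ γ x = x → (F'.SV w).obj.ρ γ x' = x' → (S.SV w).obj.ρ γ s = s) :
    (F.prod F').SplitsAt S (Sum.inl ⟨w, s⟩) := by
  intro p γ hp
  change ((F.SV w).obj.ρ γ p.1, (F'.SV w).obj.ρ γ p.2) = p at hp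
  exact h p.1 p.2 γ (congrArg Prod.fst hp) (congrArg Prod.snd hp)

/-- The same at an edge point. [cite: MochizukiSemiAnbd2006, Def 3.5(ii) p.37] -/
theorem prod_splitsAt_inr {F F' S : CovObj 𝒢} {e : 𝒢.graph.Edge} {s : (S.SE e).obj.V}
    (h : ∀ (x : (F.SE e).obj.V) (x' : (F'.SE e).obj.V) (γ : 𝒢.Ge e),
      (F.SE e).obj.ρ γ x = x → (F'.SE e).obj.ρ γ x' = x' → (S.SE e).obj.ρ γ s = s) :
    (F.prod F').SplitsAt S (Sum.inr ⟨e, s⟩) := by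
  intro p γ hp
  change ((F.SE e).obj.ρ γ p.1, (F'.SE e).obj.ρ γ p.2) = p at hp
  exact h p.1 p.2 γ (congrArg Prod.fst hp) (congrArg Prod.snd hp)

end CovObj

end ProfiniteSemiGraph

end Literature.AnabelianGeometry.SemiGraphs
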